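import Mathlib
import Summits.NavierStokesRegularity.NavierStokesRegularity.Theses.SubOnsagerCeiling
import Summits.NavierStokesRegularity.NavierStokesRegularity.Theorems.SubOnsagerCeilingKPSecondaryAssemblyGraded
import Summits.NavierStokesRegularity.NavierStokesRegularity.Theorems.SubOnsagerCeilingPerViscositySuffices
import HarnessLib

/-!
# The graded assembly PER VISCOSITY: a per-`ν`, per-horizon primary barrier already gives the rung target
# (helper file for the crux `SubOnsagerCeiling.ForwardTailCeilingKP`, stmt-NavierStokesRegularity-27057, `--supports`;
# hand leafhand-ns-subonsagerceiling-4 gen 23)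

The registered skeleton «kp-shell-barrier» (Cruxes/ForwardTailCeilingKP/Lines/kp_shell_barrier.lean, sha 84c342fe) reduces the
crux to the two stubs `PrimaryGradedAt R ε₀ α` (large / small ratio): SOME grading of the modes with the structural clauses
and a `ν`-UNIFORM `θ`-shell barrier of the level-`0` modes, `θ ∈ (1/2, 1]`, `D` chosen BEFORE `ν`, through LEAD SE's
class-level graded assembly `fwdCeilingKP_of_gradedEnvelope`.  The per-solution engine underneath,
`kpProper_sources_envelope_graded`, works one viscosity and one solution at a time.  Combining it with gen 23's
per-viscosity reduction (`Theorems/SubOnsagerCeilingPerViscositySuffices.lean`: the leaf needs only a per-`ν`, per-horizon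
forward-source envelope, by the `κ`-normal form of Theorem-4.2 blow-up) gives:

* `kpPerViscosityEnvelope_of_gradedPrimaryPerViscosity` — CLASS LEVEL, ONE VISCOSITY: for a KP network proper
  `α ∈ E₂(R)` (orthant, diagonal feeds), `0 < ε₀ ≤ 1`, ONE `ν > 0` and one datum `X₀`: a grading `lev ≤ L` with the
  structural clauses, an exponent `θ ∈ (1/2, 1]` and, FOR EVERY HORIZON `T`, a constant `D(T)` bounding
  `(1+ε₀)^{2θk}·½X_{i,k}(t)² ≤ D·E₀` for the level-`0` modes along every honest non-negative `ν`-viscous solution on `[0,s]`,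
  `s ≤ T` — all chosen AFTER `ν` — give the per-viscosity, per-horizon forward-source envelope of gen 23's file
  (`S = S⁺(α)`, `η = 2θ − 1`, `C(T) = 4(20R)^{2L}·max(D(T),1)/(1 − (1+ε₀)^{-2θ})·E₀`); the proof is LEAD SE's, verbatim,
  with the quantifiers moved;
* `kp_not_noGlobalCascade_of_gradedPrimaryPerViscosity` — hence `¬NoGlobalCascade ε₀ α X₀` if this holds for every `ν > 0`
  (closed items `ForwardSourceSmoothing`, discharged, and `OrthantInvariance`, hypothesis);
* **`taoLadderTarget_of_kpGradedPrimaryPerViscosity`** — the rung target `Theses.TaoLadderRungTwoBreak.Target` from the two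
  declared residuals, `OrthantInvariance`, and the PER-VISCOSITY PRIMARY GRADED BARRIER of the KP networks proper of `E₂(R)`
  AT SMALL RATIOS ONLY: `∀ R ≥ 1, ∃ εR > 0, ∀ ε₀ ∈ (0, εR], ∀ α, … ∀ X₀, ∀ ν > 0, ∃ lev L θ, ∀ T > 0, ∃ D, …`;
* `gradedPrimaryPerViscosity_of_primaryGraded` — nothing is lost: the registered stub currency (`D` before `ν`, verbatim the
  body of `PrimaryGradedAt`) implies the per-viscosity one.

So the registered stubs may be re-typed with `∃ lev L θ` AFTER `ν` and `∃ D` AFTER the horizon `T` (and STUB 1 dropped, gen 22),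
without touching the composition idea.  HONEST FRAMING: a by-name REDUCTION between statements about Tao-type MODEL lattice
ODEs (route SubOnsagerCeiling, rung TL-M2Break); the per-viscosity primary barrier is OPEN (for the one-mode chain it is a
Barbato–Morandin–Romito-type statement at scale ratio `1 + ε₀`, in print at ratio `2` only); no stub, crux, rung target or
summit is proved here and nothing bears on Navier–Stokes regularity.
[cite: Tao2016AveragedNS, §4 Thm. 4.2, (4.13)] [cite: BarbatoMorandinRomito2011, Thm. 1]
-/

noncomputable section

-- the sub-problem namespace `NavierStokesRegularity.NavierStokesRegularity` is the tree's layout (D-0017)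
set_option linter.dupNamespace false

namespace Summit.NavierStokesRegularity.NavierStokesRegularity.Theorems

open Set Finset Filter Topology
open Literature.Analysis.FluidPDE.TaoCascade
open Summit.NavierStokesRegularity.NavierStokesRegularity.Theses.SubOnsagerCeiling

/-- **THE GRADED ASSEMBLY, PER VISCOSITY (class level, one `ν`, one datum).**  KP network proper `α ∈ E₂(R)`,
`0 < ε₀ ≤ 1`, a viscosity `ν > 0` and a datum `X₀`.  IF some grading `lev ≤ L` of the modes satisfies the structural clauses
of `fwdCeilingKP_of_gradedEnvelope` and, for some `θ ∈ (1/2, 1]` and FOR EVERY HORIZON `T > 0` some `D`, the level-`0` modes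
obey `(1+ε₀)^{2θk}·½X_{i,k}(t)² ≤ D·E₀` along every honest non-negative `ν`-viscous solution on `[0,s]`, `s ≤ T`, THEN the
forward-source partial tails obey `Σ_{k=n..N} Σ_{i∈S⁺(α)} ½X_{i,k}(t)² ≤ C(T)·(1+ε₀)^{-(1+η)n}` with `η = 2θ − 1` and
`C(T) = 4(20R)^{2L}·max(D,1)/(1 − (1+ε₀)^{-2θ})·E₀` — the per-viscosity, per-horizon envelope consumed by
`kp_viscousGlobal_of_perViscosityEnvelope`. LEAD SE's proof of `fwdCeilingKP_of_gradedEnvelope` verbatim, quantifiers moved.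
MODEL lattice statement. [cite: Tao2016AveragedNS, §4 (4.13)] -/
theorem kpPerViscosityEnvelope_of_gradedPrimaryPerViscosity {R ε₀ ν : ℝ}
    {α : Fin 4 → Fin 4 → Fin 4 → ℤ × ℤ × ℤ → ℝ}
    (hR : 1 ≤ R) (hε : 0 < ε₀) (hε1 : ε₀ ≤ 1) (hν : 0 < ν)
    (hα : InTableClass R α)
    (hO : ∀ (Y : Fin 4 → ℤ → ℝ → ℝ) (τ : ℝ), (∀ (j : Fin 4) (k : ℤ), 1 ≤ k → 0 ≤ Y j k τ) →
      ∀ δ : ℝ, 0 < δ → ∀ (i : Fin 4) (n : ℤ), 1 ≤ n → Y i n τ = 0 → 0 ≤ quadTerm δ α Y i n τ)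
    (hDg : ∀ a b i : Fin 4, a ≠ b → α a b i (0, 0, 1) = 0) {X₀ : Fin 4 → ℝ}
    (hprim : ∃ (lev : Fin 4 → ℕ) (L : ℕ), (∀ a, lev a ≤ L) ∧
      (∀ a, lev a ≠ 0 → (∃ e, α a a e (0, 0, 1) ≠ 0) →
        (∀ j, α j j a (0, 0, 1) ≠ 0 → lev j < lev a ∧ (lev j = 0 ∨ ∃ e', α j j e' (0, 0, 1) ≠ 0)) ∧
        (∀ i₁ i₂, i₁ ≠ a → i₂ ≠ a → α i₁ i₂ a (0, 0, 0) ≠ 0 →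
          (lev i₁ < lev a ∧ (lev i₁ = 0 ∨ ∃ e', α i₁ i₁ e' (0, 0, 1) ≠ 0)) ∧
          (lev i₂ < lev a ∧ (lev i₂ = 0 ∨ ∃ e', α i₂ i₂ e' (0, 0, 1) ≠ 0))) ∧
        (∃ e, α a a e (0, 0, 1) ≠ 0 ∧
          (∀ j, α e e j (0, 0, 1) ≠ 0 → lev j < lev a ∧ (lev j = 0 ∨ ∃ e', α j j e' (0, 0, 1) ≠ 0)) ∧
          (∀ j, j ≠ e → α e e j (0, 0, 0) ≠ 0 →
            lev j < lev a ∧ (lev j = 0 ∨ ∃ e', α j j e' (0, 0, 1) ≠ 0)))) ∧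
      ∃ θ : ℝ, 1 / 2 < θ ∧ θ ≤ 1 ∧ ∀ T : ℝ, 0 < T → ∃ D : ℝ, ∀ s ∈ Set.Ioc (0 : ℝ) T,
        ∀ X : Fin 4 → ℤ → ℝ → ℝ,
        (∀ (i : Fin 4) (k : ℤ), X i k 0 = if k = 0 then X₀ i else 0) →
        (∀ (i : Fin 4) (k : ℤ), k < 0 → ∀ t : ℝ, X i k t = 0) →
        (∃ M : ℝ, ∀ (t : ℝ) (i : Fin 4) (k : ℤ), (1 + (1 + ε₀) ^ ((10 : ℝ) * k)) * |X i k t| ≤ M) →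
        (∀ (i : Fin 4) (k : ℤ), Continuous (X i k)) →
        (∀ (i : Fin 4) (k : ℤ), ∀ t ∈ Set.Icc (0 : ℝ) s, HasDerivWithinAt (X i k)
          (quadTerm ε₀ α X i k t - ν * (1 + ε₀) ^ ((2 : ℝ) * k) * X i k t) (Set.Icc (0 : ℝ) s) t) →
        (∀ t ∈ Set.Icc (0 : ℝ) s, ∀ (i : Fin 4) (k : ℤ), 1 ≤ k → 0 ≤ X i k t) →
        ∀ t ∈ Set.Icc (0 : ℝ) s, ∀ i, lev i = 0 → ∀ k : ℕ,
          (1 + ε₀) ^ (2 * θ * (k : ℝ)) * ((1 / 2 : ℝ) * X i (k : ℤ) t ^ 2) ≤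
            D * (∑ j : Fin 4, (1 / 2 : ℝ) * X₀ j ^ 2)) :
    ∃ S : Finset (Fin 4), (∀ i, i ∉ S → ∀ j l : Fin 4, α i j l (0, 0, 1) = 0) ∧ ∃ η : ℝ, 0 < η ∧
      ∀ T : ℝ, 0 < T → ∃ C : ℝ, ∀ s ∈ Set.Ioc (0 : ℝ) T, ∀ X : Fin 4 → ℤ → ℝ → ℝ,
        (∀ (i : Fin 4) (k : ℤ), X i k 0 = if k = 0 then X₀ i else 0) →
        (∀ (i : Fin 4) (k : ℤ), k < 0 → ∀ t : ℝ, X i k t = 0) →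
        (∃ M : ℝ, ∀ (t : ℝ) (i : Fin 4) (k : ℤ), (1 + (1 + ε₀) ^ ((10 : ℝ) * k)) * |X i k t| ≤ M) →
        (∀ (i : Fin 4) (k : ℤ), Continuous (X i k)) →
        (∀ (i : Fin 4) (k : ℤ), ∀ t ∈ Set.Icc (0 : ℝ) s, HasDerivWithinAt (X i k)
          (Literature.Analysis.FluidPDE.TaoCascade.quadTerm ε₀ α X i k t - ν * (1 + ε₀) ^ ((2 : ℝ) * k) * X i k t)
          (Set.Icc (0 : ℝ) s) t) →
        (∀ t ∈ Set.Icc (0 : ℝ) s, ∀ (i : Fin 4) (k : ℤ), 1 ≤ k → 0 ≤ X i k t) →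
        ∀ n N : ℕ, n ≤ N → ∀ t ∈ Set.Icc (0 : ℝ) s,
          ∑ k ∈ Finset.Icc n N, ∑ i ∈ S, (1 / 2 : ℝ) * X i (k : ℤ) t ^ 2 ≤ C * (1 + ε₀) ^ (-((1 + η) * (n : ℝ))) := by
  classical
  obtain ⟨lev, L, hL, hstruct, θ, hθ, hθ1, HT⟩ := hprim
  obtain ⟨hsym, hc, hcomp⟩ := hα
  have hb : (0 : ℝ) < 1 + ε₀ := by linarith
  have hb1lt : (1 : ℝ) < 1 + ε₀ := by linarith
  -- the forward sources
  set S : Finset (Fin 4) := Finset.univ.filter (fun a => ∃ e, α a a e (0, 0, 1) ≠ 0) with hSdef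
  have hSmem : ∀ a, a ∈ S ↔ ∃ e, α a a e (0, 0, 1) ≠ 0 := by
    intro a; simp [hSdef]
  -- the ratio of the geometric series
  set r : ℝ := (1 + ε₀) ^ (-(2 * θ)) with hr_def
  have hr1 : r < 1 := by
    have : (1 + ε₀) ^ (-(2 * θ)) < (1 + ε₀) ^ (0 : ℝ) :=
      Real.rpow_lt_rpow_of_exponent_lt hb1lt (by linarith)
    simpa [hr_def] using this
  have h1r : 0 < 1 - r := by linarith
  refine ⟨S, ?_, 2 * θ - 1, by linarith, ?_⟩
  · -- non-sources have no forward feed (diagonal entries by definition of `S`, off-diagonal by (hD))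
    intro i hi j l
    by_cases hij : i = j
    · subst hij
      by_contra hne
      exact hi ((hSmem i).2 ⟨l, hne⟩)
    · exact hDg i j l hij
  intro T hT
  obtain ⟨D, HD⟩ := HT T hT
  set E₀ : ℝ := ∑ j : Fin 4, (1 / 2 : ℝ) * X₀ j ^ 2 with hE₀
  have hE₀0 : 0 ≤ E₀ := Finset.sum_nonneg fun j _ => by positivity
  refine ⟨4 * (20 * R) ^ (2 * L) * max D 1 / (1 - r) * E₀, ?_⟩
  intro s hs X hdat hlow hMX hcont hder hnn n N hnN t ht
  -- the per-solution primary barrier at this horizon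
  have hprimX := HD s hs X hdat hlow hMX hcont hder hnn
  obtain ⟨Mw, hMw⟩ := hMX
  -- the crude bound `W = Mw` on every mode
  have hWbd : ∀ u ∈ Icc (0 : ℝ) s, ∀ (j : Fin 4) (k : ℤ), |X j k u| ≤ Mw := by
    intro u _ j k
    have h1 := hMw u j k
    have h2 : (1 : ℝ) ≤ 1 + (1 + ε₀) ^ ((10 : ℝ) * k) := by
      have := Real.rpow_pos_of_pos hb ((10 : ℝ) * k); linarith
    have h3 : |X j k u| ≤ (1 + (1 + ε₀) ^ ((10 : ℝ) * k)) * |X j k u| :=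
      le_mul_of_one_le_left (abs_nonneg _) h2
    exact h3.trans h1
  -- the energy bound at shell 0: `½X_{j,0}(u)² ≤ E₀`
  have hshell0 : ∀ u ∈ Icc (0 : ℝ) s, ∀ j, (1 / 2 : ℝ) * X j 0 u ^ 2 ≤ E₀ := by
    intro u hu j
    have hEn := orthantBreak_energy_le hε hν hc hdat hlow hMw hder hu
    have hsum : Summable fun m : ℕ => ∑ i : Fin 4, (1 / 2 : ℝ) * X i (m : ℤ) u ^ 2 :=
      (orthantBreak_summable hε hMw 0 u).congr fun m => by simp
    have h0le : (∑ i : Fin 4, (1 / 2 : ℝ) * X i ((0 : ℕ) : ℤ) u ^ 2) ≤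
        ∑' m : ℕ, ∑ i : Fin 4, (1 / 2 : ℝ) * X i (m : ℤ) u ^ 2 :=
      hsum.le_tsum 0 (fun m _ => Finset.sum_nonneg fun i _ => by positivity)
    have hj : (1 / 2 : ℝ) * X j 0 u ^ 2 ≤ ∑ i : Fin 4, (1 / 2 : ℝ) * X i ((0 : ℕ) : ℤ) u ^ 2 := by
      have := Finset.single_le_sum (f := fun i => (1 / 2 : ℝ) * X i ((0 : ℕ) : ℤ) u ^ 2)
        (fun i _ => by positivity) (Finset.mem_univ j)
      simpa using this
    simpa [hE₀] using hj.trans (h0le.trans hEn)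
  -- envelope scale `M₀ = √(2 max(D,1) E₀)`
  set M₀ : ℝ := Real.sqrt (2 * max D 1 * E₀) with hM₀
  have hM₀0 : 0 ≤ M₀ := Real.sqrt_nonneg _
  have hD1 : D ≤ max D 1 := le_max_left _ _
  have h1D : (1 : ℝ) ≤ max D 1 := le_max_right _ _
  have hM₀sq : M₀ ^ 2 = 2 * max D 1 * E₀ := by
    rw [hM₀, Real.sq_sqrt (by positivity)]
  -- the primary envelope in amplitude form
  have hPamp : ∀ u ∈ Icc (0 : ℝ) s, ∀ i, lev i = 0 → ∀ k : ℕ,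
      |X i (k : ℤ) u| ≤ M₀ * (1 + ε₀) ^ (-(θ * (k : ℝ))) := by
    intro u hu i hi k
    have h := hprimX u hu i hi k
    have hw : 0 < (1 + ε₀) ^ (2 * θ * (k : ℝ)) := Real.rpow_pos_of_pos hb _
    have hc' : 0 < (1 + ε₀) ^ (-(θ * (k : ℝ))) := Real.rpow_pos_of_pos hb _
    have hinv : (1 + ε₀) ^ (2 * θ * (k : ℝ)) * ((1 + ε₀) ^ (-(θ * (k : ℝ)))) ^ 2 = 1 := by
      rw [← Real.rpow_natCast, ← Real.rpow_mul hb.le, ← Real.rpow_add hb]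
      have : 2 * θ * (k : ℝ) + -(θ * (k : ℝ)) * ((2 : ℕ) : ℝ) = 0 := by push_cast; ring
      rw [this, Real.rpow_zero]
    have hx2 : X i (k : ℤ) u ^ 2 ≤ (M₀ * (1 + ε₀) ^ (-(θ * (k : ℝ)))) ^ 2 := by
      rw [mul_pow, hM₀sq]
      have hDE : D * E₀ ≤ max D 1 * E₀ := mul_le_mul_of_nonneg_right hD1 hE₀0
      have hmul := mul_le_mul_of_nonneg_right (h.trans hDE) (sq_nonneg ((1 + ε₀) ^ (-(θ * (k : ℝ)))))
      have hlhs : (1 + ε₀) ^ (2 * θ * (k : ℝ)) * ((1 / 2 : ℝ) * X i (k : ℤ) u ^ 2) *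
          ((1 + ε₀) ^ (-(θ * (k : ℝ)))) ^ 2 = (1 / 2 : ℝ) * X i (k : ℤ) u ^ 2 := by
        have := hinv
        calc (1 + ε₀) ^ (2 * θ * (k : ℝ)) * ((1 / 2 : ℝ) * X i (k : ℤ) u ^ 2) *
              ((1 + ε₀) ^ (-(θ * (k : ℝ)))) ^ 2
            = ((1 + ε₀) ^ (2 * θ * (k : ℝ)) * ((1 + ε₀) ^ (-(θ * (k : ℝ)))) ^ 2) *
                ((1 / 2 : ℝ) * X i (k : ℤ) u ^ 2) := by ring
          _ = (1 / 2 : ℝ) * X i (k : ℤ) u ^ 2 := by rw [this, one_mul]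
      rw [hlhs] at hmul
      nlinarith [hmul]
    have hnn' : 0 ≤ M₀ * (1 + ε₀) ^ (-(θ * (k : ℝ))) := by positivity
    exact abs_le.2 ⟨(abs_le_of_sq_le_sq' hx2 hnn').1, (abs_le_of_sq_le_sq' hx2 hnn').2⟩
  have h0amp : ∀ u ∈ Icc (0 : ℝ) s, ∀ j, |X j 0 u| ≤ M₀ := by
    intro u hu j
    have h := hshell0 u hu j
    have hx2 : X j 0 u ^ 2 ≤ M₀ ^ 2 := by
      rw [hM₀sq]; nlinarith [hE₀0, h1D, mul_nonneg (sub_nonneg.2 h1D) hE₀0]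
    exact abs_le.2 ⟨(abs_le_of_sq_le_sq' hx2 hM₀0).1, (abs_le_of_sq_le_sq' hx2 hM₀0).2⟩
  -- zero datum on shells ≥ 1
  have hdat1 : ∀ (i : Fin 4) (k : ℤ), 1 ≤ k → X i k 0 = 0 := by
    intro i k hk
    rw [hdat i k, if_neg (by omega)]
  -- every source is enveloped by `20 R (M₀ + δ)` for every `δ > 0`, hence by `20 R M₀`
  have hR20 : (1 : ℝ) ≤ 20 * R := by linarith
  have hsources : ∀ a ∈ S, ∀ k : ℕ,
      |X a (k : ℤ) t| ≤ (20 * R) ^ L * M₀ * (1 + ε₀) ^ (-(θ * (k : ℝ))) := by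
    intro a ha k
    have hsrc := (hSmem a).1 ha
    have hc' : 0 < (1 + ε₀) ^ (-(θ * (k : ℝ))) := Real.rpow_pos_of_pos hb _
    have hRL : (1 : ℝ) ≤ (20 * R) ^ L := one_le_pow₀ hR20
    apply le_of_forall_pos_le_add
    intro η hη
    set δ : ℝ := η / ((20 * R) ^ L * (1 + ε₀) ^ (-(θ * (k : ℝ)))) with hδ
    have hδpos : 0 < δ := by positivity
    have hMδ : 0 < M₀ + δ := by linarith
    have hres := kpProper_sources_envelope_graded (W := Mw) ⟨hsym, hc, hcomp⟩ hO hDg hR hε hε1 hν.le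
      (by linarith) hθ1 hMδ hder hdat1 hnn hWbd lev
      (fun u hu i hi m => (hPamp u hu i hi m).trans
        (mul_le_mul_of_nonneg_right (by linarith) (Real.rpow_pos_of_pos hb _).le))
      (fun u hu j => (h0amp u hu j).trans (by linarith)) hstruct t ht a (Or.inr hsrc) k
    have hmono : (20 * R) ^ (lev a) * (M₀ + δ) * (1 + ε₀) ^ (-(θ * (k : ℝ))) ≤
        (20 * R) ^ L * (M₀ + δ) * (1 + ε₀) ^ (-(θ * (k : ℝ))) := by
      have h1 : (20 * R) ^ (lev a) ≤ (20 * R) ^ L := pow_le_pow_right₀ hR20 (hL a)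
      have h2 : 0 ≤ (M₀ + δ) * (1 + ε₀) ^ (-(θ * (k : ℝ))) := by positivity
      nlinarith
    have : (20 * R) ^ L * (M₀ + δ) * (1 + ε₀) ^ (-(θ * (k : ℝ))) =
        (20 * R) ^ L * M₀ * (1 + ε₀) ^ (-(θ * (k : ℝ))) + η := by
      simp only [hδ]; field_simp
    linarith
  -- the geometric tail sum
  have htail := sources_tail_le (S := S) hε (by linarith) (by positivity) hsources n N hnN
  have hconst : 2 * ((20 * R) ^ L * M₀) ^ 2 / (1 - (1 + ε₀) ^ (-(2 * θ))) =
      4 * (20 * R) ^ (2 * L) * max D 1 / (1 - r) * E₀ := by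
    rw [← hr_def, mul_pow, hM₀sq, ← pow_mul]; field_simp; ring
  rw [hconst] at htail
  have hexp : -((1 + (2 * θ - 1)) * (n : ℝ)) = -(2 * θ * (n : ℝ)) := by ring
  rw [hexp]
  exact htail

/-- **Per-viscosity primary graded barrier ⇒ no Theorem-4.2 blow-up.**  If for EVERY `ν > 0` the KP network proper
`α ∈ E₂(R)` (orthant, diagonal feeds; `0 < ε₀ ≤ 1`) admits a grading with the structural clauses and a per-horizon `θ`-shell
barrier of its level-`0` modes along the honest non-negative `ν`-viscous solutions from `X₀` (all constants AFTER `ν`), then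
`¬NoGlobalCascade ε₀ α X₀` — through `kpPerViscosityEnvelope_of_gradedPrimaryPerViscosity` and gen 23's
`kp_not_noGlobalCascade_of_perViscosityEnvelope` (closed items `ForwardSourceSmoothing`, discharged there, and
`OrthantInvariance`, the hypothesis `hI`). MODEL lattice statement. [cite: Tao2016AveragedNS, §4 Thm. 4.2] -/
theorem kp_not_noGlobalCascade_of_gradedPrimaryPerViscosity (hI : OrthantInvariance) {R ε₀ : ℝ}
    {α : Fin 4 → Fin 4 → Fin 4 → ℤ × ℤ × ℤ → ℝ}
    (hR : 1 ≤ R) (hε : 0 < ε₀) (hε1 : ε₀ ≤ 1)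
    (hα : InTableClass R α)
    (hO : ∀ (Y : Fin 4 → ℤ → ℝ → ℝ) (τ : ℝ), (∀ (j : Fin 4) (k : ℤ), 1 ≤ k → 0 ≤ Y j k τ) →
      ∀ δ : ℝ, 0 < δ → ∀ (i : Fin 4) (n : ℤ), 1 ≤ n → Y i n τ = 0 → 0 ≤ quadTerm δ α Y i n τ)
    (hDg : ∀ a b i : Fin 4, a ≠ b → α a b i (0, 0, 1) = 0) {X₀ : Fin 4 → ℝ}
    (hprim : ∀ ν : ℝ, 0 < ν → ∃ (lev : Fin 4 → ℕ) (L : ℕ), (∀ a, lev a ≤ L) ∧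
      (∀ a, lev a ≠ 0 → (∃ e, α a a e (0, 0, 1) ≠ 0) →
        (∀ j, α j j a (0, 0, 1) ≠ 0 → lev j < lev a ∧ (lev j = 0 ∨ ∃ e', α j j e' (0, 0, 1) ≠ 0)) ∧
        (∀ i₁ i₂, i₁ ≠ a → i₂ ≠ a → α i₁ i₂ a (0, 0, 0) ≠ 0 →
          (lev i₁ < lev a ∧ (lev i₁ = 0 ∨ ∃ e', α i₁ i₁ e' (0, 0, 1) ≠ 0)) ∧
          (lev i₂ < lev a ∧ (lev i₂ = 0 ∨ ∃ e', α i₂ i₂ e' (0, 0, 1) ≠ 0))) ∧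
        (∃ e, α a a e (0, 0, 1) ≠ 0 ∧
          (∀ j, α e e j (0, 0, 1) ≠ 0 → lev j < lev a ∧ (lev j = 0 ∨ ∃ e', α j j e' (0, 0, 1) ≠ 0)) ∧
          (∀ j, j ≠ e → α e e j (0, 0, 0) ≠ 0 →
            lev j < lev a ∧ (lev j = 0 ∨ ∃ e', α j j e' (0, 0, 1) ≠ 0)))) ∧
      ∃ θ : ℝ, 1 / 2 < θ ∧ θ ≤ 1 ∧ ∀ T : ℝ, 0 < T → ∃ D : ℝ, ∀ s ∈ Set.Ioc (0 : ℝ) T,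
        ∀ X : Fin 4 → ℤ → ℝ → ℝ,
        (∀ (i : Fin 4) (k : ℤ), X i k 0 = if k = 0 then X₀ i else 0) →
        (∀ (i : Fin 4) (k : ℤ), k < 0 → ∀ t : ℝ, X i k t = 0) →
        (∃ M : ℝ, ∀ (t : ℝ) (i : Fin 4) (k : ℤ), (1 + (1 + ε₀) ^ ((10 : ℝ) * k)) * |X i k t| ≤ M) →
        (∀ (i : Fin 4) (k : ℤ), Continuous (X i k)) →
        (∀ (i : Fin 4) (k : ℤ), ∀ t ∈ Set.Icc (0 : ℝ) s, HasDerivWithinAt (X i k)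
          (quadTerm ε₀ α X i k t - ν * (1 + ε₀) ^ ((2 : ℝ) * k) * X i k t) (Set.Icc (0 : ℝ) s) t) →
        (∀ t ∈ Set.Icc (0 : ℝ) s, ∀ (i : Fin 4) (k : ℤ), 1 ≤ k → 0 ≤ X i k t) →
        ∀ t ∈ Set.Icc (0 : ℝ) s, ∀ i, lev i = 0 → ∀ k : ℕ,
          (1 + ε₀) ^ (2 * θ * (k : ℝ)) * ((1 / 2 : ℝ) * X i (k : ℤ) t ^ 2) ≤
            D * (∑ j : Fin 4, (1 / 2 : ℝ) * X₀ j ^ 2)) :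
    ¬ NoGlobalCascade ε₀ α X₀ :=
  kp_not_noGlobalCascade_of_perViscosityEnvelope hI hε hα hO
    (fun ν hν => kpPerViscosityEnvelope_of_gradedPrimaryPerViscosity hR hε hε1 hν hα hO hDg (hprim ν hν))

/-- **THE RUNG TARGET FROM THE PER-VISCOSITY PRIMARY GRADED BARRIER AT SMALL RATIOS.**
`Theses.TaoLadderRungTwoBreak.Target` follows from the two declared residual cruxes `NonDiagonalOrthantBreak` (stmt-27000),
`NonOrthantBreak` (stmt-24640), the closed item `OrthantInvariance` (hypothesis), and: for every `R ≥ 1` some `εR ∈ (0, 1]`…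
more precisely some `εR > 0` such that for `ε₀ ≤ min εR 1`, every KP network proper `α ∈ E₂(R)`, every datum `X₀` and EVERY
`ν > 0` admit a grading `lev ≤ L` with the structural clauses, `θ ∈ (1/2, 1]` and per-horizon constants `D(T)` for the
`θ`-shell barrier of the level-`0` modes (the registered stubs' `PrimaryGradedAt` with `∃ lev L θ` moved AFTER `ν` and `∃ D`
AFTER the horizon).  A reduction between statements (the hypothesis is OPEN); MODEL lattice only.
[cite: Tao2016AveragedNS, §4 Thm. 4.2] -/
theorem taoLadderTarget_of_kpGradedPrimaryPerViscosity
    (hG : ∀ R : ℝ, 1 ≤ R → ∃ εR : ℝ, 0 < εR ∧ εR ≤ 1 ∧ ∀ ε₀ : ℝ, 0 < ε₀ → ε₀ ≤ εR →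
      ∀ α : Fin 4 → Fin 4 → Fin 4 → ℤ × ℤ × ℤ → ℝ,
      InTableClass R α →
      (∀ (Y : Fin 4 → ℤ → ℝ → ℝ) (τ : ℝ), (∀ (j : Fin 4) (k : ℤ), 1 ≤ k → 0 ≤ Y j k τ) → ∀ δ : ℝ, 0 < δ →
        ∀ (i : Fin 4) (n : ℤ), 1 ≤ n → Y i n τ = 0 → 0 ≤ quadTerm δ α Y i n τ) →
      (∀ a b i : Fin 4, a ≠ b → α a b i (0, 0, 1) = 0) →
      ∀ (X₀ : Fin 4 → ℝ) (ν : ℝ), 0 < ν → ∃ (lev : Fin 4 → ℕ) (L : ℕ), (∀ a, lev a ≤ L) ∧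
      (∀ a, lev a ≠ 0 → (∃ e, α a a e (0, 0, 1) ≠ 0) →
        (∀ j, α j j a (0, 0, 1) ≠ 0 → lev j < lev a ∧ (lev j = 0 ∨ ∃ e', α j j e' (0, 0, 1) ≠ 0)) ∧
        (∀ i₁ i₂, i₁ ≠ a → i₂ ≠ a → α i₁ i₂ a (0, 0, 0) ≠ 0 →
          (lev i₁ < lev a ∧ (lev i₁ = 0 ∨ ∃ e', α i₁ i₁ e' (0, 0, 1) ≠ 0)) ∧
          (lev i₂ < lev a ∧ (lev i₂ = 0 ∨ ∃ e', α i₂ i₂ e' (0, 0, 1) ≠ 0))) ∧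
        (∃ e, α a a e (0, 0, 1) ≠ 0 ∧
          (∀ j, α e e j (0, 0, 1) ≠ 0 → lev j < lev a ∧ (lev j = 0 ∨ ∃ e', α j j e' (0, 0, 1) ≠ 0)) ∧
          (∀ j, j ≠ e → α e e j (0, 0, 0) ≠ 0 →
            lev j < lev a ∧ (lev j = 0 ∨ ∃ e', α j j e' (0, 0, 1) ≠ 0)))) ∧
      ∃ θ : ℝ, 1 / 2 < θ ∧ θ ≤ 1 ∧ ∀ T : ℝ, 0 < T → ∃ D : ℝ, ∀ s ∈ Set.Ioc (0 : ℝ) T,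
        ∀ X : Fin 4 → ℤ → ℝ → ℝ,
        (∀ (i : Fin 4) (k : ℤ), X i k 0 = if k = 0 then X₀ i else 0) →
        (∀ (i : Fin 4) (k : ℤ), k < 0 → ∀ t : ℝ, X i k t = 0) →
        (∃ M : ℝ, ∀ (t : ℝ) (i : Fin 4) (k : ℤ), (1 + (1 + ε₀) ^ ((10 : ℝ) * k)) * |X i k t| ≤ M) →
        (∀ (i : Fin 4) (k : ℤ), Continuous (X i k)) →
        (∀ (i : Fin 4) (k : ℤ), ∀ t ∈ Set.Icc (0 : ℝ) s, HasDerivWithinAt (X i k)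
          (quadTerm ε₀ α X i k t - ν * (1 + ε₀) ^ ((2 : ℝ) * k) * X i k t) (Set.Icc (0 : ℝ) s) t) →
        (∀ t ∈ Set.Icc (0 : ℝ) s, ∀ (i : Fin 4) (k : ℤ), 1 ≤ k → 0 ≤ X i k t) →
        ∀ t ∈ Set.Icc (0 : ℝ) s, ∀ i, lev i = 0 → ∀ k : ℕ,
          (1 + ε₀) ^ (2 * θ * (k : ℝ)) * ((1 / 2 : ℝ) * X i (k : ℤ) t ^ 2) ≤
            D * (∑ j : Fin 4, (1 / 2 : ℝ) * X₀ j ^ 2))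
    (h2 : OrthantInvariance) (h5 : NonDiagonalOrthantBreak) (h4 : NonOrthantBreak) :
    Summit.NavierStokesRegularity.NavierStokesRegularity.Theses.TaoLadderRungTwoBreak.Target := by
  refine taoLadderTarget_of_kpPerViscosityEnvelope ?_ h2 h5 h4
  intro R hR
  obtain ⟨εR, hεR, hεR1, HG⟩ := hG R hR
  refine ⟨εR, hεR, fun ε₀ h0 hle α hα hO hD X₀ ν hν => ?_⟩
  exact kpPerViscosityEnvelope_of_gradedPrimaryPerViscosity hR h0 (hle.trans hεR1) hν hα hO hD
    (HG ε₀ h0 hle α hα hO hD X₀ ν hν)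

/-- **Nothing is lost**: the registered stub currency — verbatim the body of the skeleton's `PrimaryGradedAt R ε₀ α`
(grading and `θ, D` chosen BEFORE `ν`, barrier on every window `[0, s]`) — implies the per-viscosity primary graded barrier
for every datum and every `ν > 0` (same grading, same `θ`, `D` independent of the horizon). [cite: Tao2016AveragedNS, §4 (4.13)] -/
theorem gradedPrimaryPerViscosity_of_primaryGraded {R ε₀ : ℝ} {α : Fin 4 → Fin 4 → Fin 4 → ℤ × ℤ × ℤ → ℝ}
    (hPG : InTableClass R α →
      (∀ (Y : Fin 4 → ℤ → ℝ → ℝ) (τ : ℝ), (∀ (j : Fin 4) (k : ℤ), 1 ≤ k → 0 ≤ Y j k τ) → ∀ δ : ℝ, 0 < δ →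
        ∀ (i : Fin 4) (n : ℤ), 1 ≤ n → Y i n τ = 0 → 0 ≤ quadTerm δ α Y i n τ) →
      (∀ a b i : Fin 4, a ≠ b → α a b i (0, 0, 1) = 0) →
      ∃ (lev : Fin 4 → ℕ) (L : ℕ), (∀ a, lev a ≤ L) ∧
      (∀ a, lev a ≠ 0 → (∃ e, α a a e (0, 0, 1) ≠ 0) →
        (∀ j, α j j a (0, 0, 1) ≠ 0 → lev j < lev a ∧ (lev j = 0 ∨ ∃ e', α j j e' (0, 0, 1) ≠ 0)) ∧
        (∀ i₁ i₂, i₁ ≠ a → i₂ ≠ a → α i₁ i₂ a (0, 0, 0) ≠ 0 →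
          (lev i₁ < lev a ∧ (lev i₁ = 0 ∨ ∃ e', α i₁ i₁ e' (0, 0, 1) ≠ 0)) ∧
          (lev i₂ < lev a ∧ (lev i₂ = 0 ∨ ∃ e', α i₂ i₂ e' (0, 0, 1) ≠ 0))) ∧
        (∃ e, α a a e (0, 0, 1) ≠ 0 ∧
          (∀ j, α e e j (0, 0, 1) ≠ 0 → lev j < lev a ∧ (lev j = 0 ∨ ∃ e', α j j e' (0, 0, 1) ≠ 0)) ∧
          (∀ j, j ≠ e → α e e j (0, 0, 0) ≠ 0 →
            lev j < lev a ∧ (lev j = 0 ∨ ∃ e', α j j e' (0, 0, 1) ≠ 0)))) ∧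
      ∃ θ : ℝ, 1 / 2 < θ ∧ θ ≤ 1 ∧ ∃ D : ℝ, 0 ≤ D ∧
        ∀ ν : ℝ, 0 < ν → ∀ (X₀ : Fin 4 → ℝ) (s : ℝ), 0 < s → ∀ X : Fin 4 → ℤ → ℝ → ℝ,
        (∀ (i : Fin 4) (k : ℤ), X i k 0 = if k = 0 then X₀ i else 0) →
        (∀ (i : Fin 4) (k : ℤ), k < 0 → ∀ t : ℝ, X i k t = 0) →
        (∃ M : ℝ, ∀ (t : ℝ) (i : Fin 4) (k : ℤ), (1 + (1 + ε₀) ^ ((10 : ℝ) * k)) * |X i k t| ≤ M) →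
        (∀ (i : Fin 4) (k : ℤ), Continuous (X i k)) →
        (∀ (i : Fin 4) (k : ℤ), ∀ t ∈ Set.Icc (0 : ℝ) s, HasDerivWithinAt (X i k)
          (quadTerm ε₀ α X i k t - ν * (1 + ε₀) ^ ((2 : ℝ) * k) * X i k t) (Set.Icc (0 : ℝ) s) t) →
        (∀ t ∈ Set.Icc (0 : ℝ) s, ∀ (i : Fin 4) (k : ℤ), 1 ≤ k → 0 ≤ X i k t) →
        ∀ t ∈ Set.Icc (0 : ℝ) s, ∀ i, lev i = 0 → ∀ k : ℕ,
          (1 + ε₀) ^ (2 * θ * (k : ℝ)) * ((1 / 2 : ℝ) * X i (k : ℤ) t ^ 2) ≤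
            D * (∑ j : Fin 4, (1 / 2 : ℝ) * X₀ j ^ 2))
    (hα : InTableClass R α)
    (hO : ∀ (Y : Fin 4 → ℤ → ℝ → ℝ) (τ : ℝ), (∀ (j : Fin 4) (k : ℤ), 1 ≤ k → 0 ≤ Y j k τ) →
      ∀ δ : ℝ, 0 < δ → ∀ (i : Fin 4) (n : ℤ), 1 ≤ n → Y i n τ = 0 → 0 ≤ quadTerm δ α Y i n τ)
    (hDg : ∀ a b i : Fin 4, a ≠ b → α a b i (0, 0, 1) = 0) (X₀ : Fin 4 → ℝ) {ν : ℝ} (hν : 0 < ν) :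
    ∃ (lev : Fin 4 → ℕ) (L : ℕ), (∀ a, lev a ≤ L) ∧
      (∀ a, lev a ≠ 0 → (∃ e, α a a e (0, 0, 1) ≠ 0) →
        (∀ j, α j j a (0, 0, 1) ≠ 0 → lev j < lev a ∧ (lev j = 0 ∨ ∃ e', α j j e' (0, 0, 1) ≠ 0)) ∧
        (∀ i₁ i₂, i₁ ≠ a → i₂ ≠ a → α i₁ i₂ a (0, 0, 0) ≠ 0 →
          (lev i₁ < lev a ∧ (lev i₁ = 0 ∨ ∃ e', α i₁ i₁ e' (0, 0, 1) ≠ 0)) ∧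
          (lev i₂ < lev a ∧ (lev i₂ = 0 ∨ ∃ e', α i₂ i₂ e' (0, 0, 1) ≠ 0))) ∧
        (∃ e, α a a e (0, 0, 1) ≠ 0 ∧
          (∀ j, α e e j (0, 0, 1) ≠ 0 → lev j < lev a ∧ (lev j = 0 ∨ ∃ e', α j j e' (0, 0, 1) ≠ 0)) ∧
          (∀ j, j ≠ e → α e e j (0, 0, 0) ≠ 0 →
            lev j < lev a ∧ (lev j = 0 ∨ ∃ e', α j j e' (0, 0, 1) ≠ 0)))) ∧
      ∃ θ : ℝ, 1 / 2 < θ ∧ θ ≤ 1 ∧ ∀ T : ℝ, 0 < T → ∃ D : ℝ, ∀ s ∈ Set.Ioc (0 : ℝ) T,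
        ∀ X : Fin 4 → ℤ → ℝ → ℝ,
        (∀ (i : Fin 4) (k : ℤ), X i k 0 = if k = 0 then X₀ i else 0) →
        (∀ (i : Fin 4) (k : ℤ), k < 0 → ∀ t : ℝ, X i k t = 0) →
        (∃ M : ℝ, ∀ (t : ℝ) (i : Fin 4) (k : ℤ), (1 + (1 + ε₀) ^ ((10 : ℝ) * k)) * |X i k t| ≤ M) →
        (∀ (i : Fin 4) (k : ℤ), Continuous (X i k)) →
        (∀ (i : Fin 4) (k : ℤ), ∀ t ∈ Set.Icc (0 : ℝ) s, HasDerivWithinAt (X i k)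
          (quadTerm ε₀ α X i k t - ν * (1 + ε₀) ^ ((2 : ℝ) * k) * X i k t) (Set.Icc (0 : ℝ) s) t) →
        (∀ t ∈ Set.Icc (0 : ℝ) s, ∀ (i : Fin 4) (k : ℤ), 1 ≤ k → 0 ≤ X i k t) →
        ∀ t ∈ Set.Icc (0 : ℝ) s, ∀ i, lev i = 0 → ∀ k : ℕ,
          (1 + ε₀) ^ (2 * θ * (k : ℝ)) * ((1 / 2 : ℝ) * X i (k : ℤ) t ^ 2) ≤
            D * (∑ j : Fin 4, (1 / 2 : ℝ) * X₀ j ^ 2) := by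
  obtain ⟨lev, L, hL, hstruct, θ, hθ, hθ1, D, _hD, H⟩ := hPG hα hO hDg
  exact ⟨lev, L, hL, hstruct, θ, hθ, hθ1, fun T _hT => ⟨D, fun s hs X hdat hlow hM hcont hder hnn =>
    H ν hν X₀ s hs.1 X hdat hlow hM hcont hder hnn⟩⟩

end Summit.NavierStokesRegularity.NavierStokesRegularity.Theorems

end
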